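import Literature.Geometry.Riemannian.GurskyViaclovskyClosednessConcavity
import Mathlib.Analysis.SpecialFunctions.SmoothTransition
import Mathlib.Analysis.SpecialFunctions.Sqrt
import HarnessLib

/-!
# Gursky–Viaclovsky closedness: two glue lemmas for the Evans–Krylov step

Support file (everything PROVED; no definition, no named fact) for the named fact
`Literature.Geometry.Riemannian.gurskyViaclovsky_pathClosed_weighted_four` (see the unit's
assembly map of Gilbarg–Trudinger's proof of Thm. 17.14 for the chart equation):

* `sigma2_mul_sigma2_le_sq_sigma2Polar` — the **reverse Cauchy–Schwarz inequality** of the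
  hyperbolic quadratic form `σ₂` at an admissible array: `σ₂(A)σ₂(B) ≤ σ₂(A,B)²` for
  `A ∈ Γ₂⁺` and ANY symmetric `B` (from Gårding's inequality applied to `±B`);
* `hasDerivAt_sqrt_sigma2_line`, `sqrt_sigma2_line_second_deriv_nonpos` — along every line
  `s ↦ A + sB` through `A ∈ Γ₂⁺` the function `σ₂^{1/2}` has second derivative
  `(σ₂(A)σ₂(B) − σ₂(A,B)²)/σ₂(A)^{3/2} ≤ 0` at `s = 0`: the infinitesimal form of hypothesis
  (ii)' ("`F_{ij,kl} ≤ 0`", Gilbarg–Trudinger (17.45)) for `F = σ₂^{1/2}`;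
* `exists_smooth_sqrt_cutoff` — for `c > 0` a `ψ ∈ C^∞(ℝ)` with `ψ(s) = √s` for `s ≥ c/2` and
  `ψ ≥ √(c/4)` everywhere (so `F = ψ ∘ Σ` is globally `C^∞` and equals `σ₂^{1/2}` on the admissible
  jets with margin, as required by `F ∈ C²(Γ)` in Thm. 17.14).

## References

* M. J. Gursky, J. A. Viaclovsky, J. Differential Geom. 63 (2003) 131–154, §2 Prop. 1 (iii).
  [GurskyViaclovsky2003]
* D. Gilbarg, N. S. Trudinger, *Elliptic Partial Differential Equations of Second Order* (2001),
  §17.4, (17.45) and the hypothesis `F ∈ C²(Γ)` of Thm. 17.14. [GilbargTrudinger2001]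
-/

noncomputable section

open scoped ContDiff Topology
open Finset Real

namespace Literature.Geometry.Riemannian.GurskyViaclovsky

/-! ### Reverse Cauchy–Schwarz for `σ₂` at an admissible array -/

section ReverseCS

variable {A B : Fin 4 → Fin 4 → ℝ}

/-- `σ₂(−B) = σ₂(B)`, `σ₁(−B) = −σ₁(B)`, `σ₂(A, −B) = −σ₂(A, B)`. [folklore] -/
theorem sigma_neg (A B : Fin 4 → Fin 4 → ℝ) :
    sigma2 (fun a b ↦ -B a b) = sigma2 B ∧ sigma1 (fun a b ↦ -B a b) = -sigma1 B ∧
      sigma2Polar A (fun a b ↦ -B a b) = -sigma2Polar A B := by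
  simp only [sigma2, sigma1, sigma2Polar, frameInner, Fin.sum_univ_four]
  refine ⟨by ring, by ring, by ring⟩

/-- **Reverse Cauchy–Schwarz for `σ₂`**: for symmetric `A ∈ Γ₂⁺` and any symmetric `B`,
`σ₂(A)σ₂(B) ≤ σ₂(A,B)²` (if `σ₂(B) ≤ 0` trivially; otherwise `B` or `−B` lies in `Γ₂⁺` and
Gårding's inequality `σ₂(A)^{1/2}σ₂(±B)^{1/2} ≤ σ₂(A, ±B)` squares to the claim).
[cite: GurskyViaclovsky2003, §2 Prop. 1 (iii)] -/
theorem sigma2_mul_sigma2_le_sq_sigma2Polar (hA : ∀ a b, A a b = A b a) (hB : ∀ a b, B a b = B b a)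
    (hΓA : GammaTwoPos A) : sigma2 A * sigma2 B ≤ sigma2Polar A B ^ 2 := by
  by_cases h2 : sigma2 B ≤ 0
  · exact (mul_nonpos_iff.2 (Or.inl ⟨hΓA.2.le, h2⟩)).trans (sq_nonneg _)
  · push Not at h2
    have h1ne : sigma1 B ≠ 0 := by
      intro h0
      have h := sigma2_eq hB
      rw [h0] at h
      have hn : 0 ≤ frameNormSq B := Finset.sum_nonneg fun a _ ↦ Finset.sum_nonneg fun b _ ↦ sq_nonneg _
      linarith
    rcases lt_or_gt_of_ne h1ne with hneg | hpos
    · -- `−B ∈ Γ₂⁺`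
      obtain ⟨e2, e1, eP⟩ := sigma_neg A B
      have hBn : ∀ a b, (fun a b ↦ -B a b) a b = (fun a b ↦ -B a b) b a := fun a b ↦ by
        simp only [hB a b]
      have hΓ : GammaTwoPos (fun a b ↦ -B a b) := ⟨by rw [e1]; linarith, by rw [e2]; exact h2⟩
      have hG := sqrt_mul_sqrt_le_sigma2Polar hA hBn hΓA hΓ
      rw [e2, eP] at hG
      have h0 : 0 ≤ Real.sqrt (sigma2 A) * Real.sqrt (sigma2 B) := by positivity
      calc sigma2 A * sigma2 B = (Real.sqrt (sigma2 A) * Real.sqrt (sigma2 B)) ^ 2 := by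
            rw [mul_pow, Real.sq_sqrt hΓA.2.le, Real.sq_sqrt h2.le]
        _ ≤ (-sigma2Polar A B) ^ 2 := pow_le_pow_left₀ h0 hG 2
        _ = sigma2Polar A B ^ 2 := by ring
    · have hΓ : GammaTwoPos B := ⟨hpos, h2⟩
      have hG := sqrt_mul_sqrt_le_sigma2Polar hA hB hΓA hΓ
      have h0 : 0 ≤ Real.sqrt (sigma2 A) * Real.sqrt (sigma2 B) := by positivity
      calc sigma2 A * sigma2 B = (Real.sqrt (sigma2 A) * Real.sqrt (sigma2 B)) ^ 2 := by
            rw [mul_pow, Real.sq_sqrt hΓA.2.le, Real.sq_sqrt h2.le]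
        _ ≤ sigma2Polar A B ^ 2 := pow_le_pow_left₀ h0 hG 2

/-! ### `σ₂^{1/2}` along lines: first and second derivative -/

/-- `σ₂` along the line `A + sB`: `σ₂(A + sB) = σ₂(A) + 2sσ₂(A,B) + s²σ₂(B)`. [folklore] -/
theorem sigma2_line (hA : ∀ a b, A a b = A b a) (hB : ∀ a b, B a b = B b a) (s : ℝ) :
    sigma2 (fun a b ↦ A a b + s * B a b) = sigma2 A + 2 * sigma2Polar A B * s + sigma2 B * s ^ 2 := by
  have h : (fun a b ↦ A a b + s * B a b) = fun a b ↦ 1 * A a b + s * B a b := by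
    funext a b; ring
  rw [h, sigma2_smul_add_smul hA hB 1 s]
  ring

/-- The derivative of `s ↦ σ₂(A + sB)`. [folklore] -/
theorem hasDerivAt_sigma2_line (hA : ∀ a b, A a b = A b a) (hB : ∀ a b, B a b = B b a) (s : ℝ) :
    HasDerivAt (fun s : ℝ ↦ sigma2 (fun a b ↦ A a b + s * B a b))
      (2 * sigma2Polar A B + 2 * sigma2 B * s) s := by
  have hfun : (fun s : ℝ ↦ sigma2 (fun a b ↦ A a b + s * B a b)) =
      fun s ↦ sigma2 A + 2 * sigma2Polar A B * s + sigma2 B * s ^ 2 := by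
    funext s; exact sigma2_line hA hB s
  rw [hfun]
  have h1 : HasDerivAt (fun s : ℝ ↦ 2 * sigma2Polar A B * s) (2 * sigma2Polar A B) s := by
    simpa using (hasDerivAt_id s).const_mul (2 * sigma2Polar A B)
  have h2 : HasDerivAt (fun s : ℝ ↦ sigma2 B * s ^ 2) (sigma2 B * (2 * s)) s := by
    simpa using (hasDerivAt_pow 2 s).const_mul (sigma2 B)
  have h := (h1.add h2).const_add (sigma2 A)
  have hfun2 : (fun s : ℝ ↦ sigma2 A + 2 * sigma2Polar A B * s + sigma2 B * s ^ 2) =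
      fun s ↦ sigma2 A + (2 * sigma2Polar A B * s + sigma2 B * s ^ 2) := by
    funext s; ring
  rw [hfun2]
  exact h.congr_deriv (by ring)

/-- **First derivative of `σ₂^{1/2}` along a line** where `σ₂ > 0`:
`d/ds σ₂^{1/2}(A + sB) = (σ₂(A,B) + sσ₂(B))/σ₂^{1/2}(A + sB)`. [folklore] -/
theorem hasDerivAt_sqrt_sigma2_line (hA : ∀ a b, A a b = A b a) (hB : ∀ a b, B a b = B b a)
    {s : ℝ} (hs : 0 < sigma2 (fun a b ↦ A a b + s * B a b)) :
    HasDerivAt (fun s : ℝ ↦ Real.sqrt (sigma2 (fun a b ↦ A a b + s * B a b)))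
      ((sigma2Polar A B + sigma2 B * s) / Real.sqrt (sigma2 (fun a b ↦ A a b + s * B a b))) s := by
  have h := (hasDerivAt_sigma2_line hA hB s).sqrt hs.ne'
  refine h.congr_deriv ?_
  have hsq : Real.sqrt (sigma2 fun a b ↦ A a b + s * B a b) ≠ 0 := (Real.sqrt_pos.2 hs).ne'
  field_simp

/-- **Second derivative of `σ₂^{1/2}` along a line at an admissible array is `≤ 0`**
(the infinitesimal concavity `F_{ij,kl}η_{ij}η_{kl} ≤ 0` used in Gilbarg–Trudinger (17.45),
for `F = σ₂^{1/2}`): for symmetric `A ∈ Γ₂⁺` and symmetric `B`, the derivative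
`g'(s) = (σ₂(A,B) + sσ₂(B))/σ₂^{1/2}(A + sB)` of `g(s) = σ₂^{1/2}(A + sB)` satisfies
`g''(0) = (σ₂(A)σ₂(B) − σ₂(A,B)²)/σ₂(A)^{3/2} ≤ 0`.
[cite: GurskyViaclovsky2003, §2 Prop. 1 (iii)] [cite: GilbargTrudinger2001, §17.4, (17.45)] -/
theorem sqrt_sigma2_line_second_deriv_nonpos (hA : ∀ a b, A a b = A b a)
    (hB : ∀ a b, B a b = B b a) (hΓA : GammaTwoPos A) :
    HasDerivAt (fun s : ℝ ↦ (sigma2Polar A B + sigma2 B * s) /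
        Real.sqrt (sigma2 (fun a b ↦ A a b + s * B a b)))
      ((sigma2 A * sigma2 B - sigma2Polar A B ^ 2) / (sigma2 A * Real.sqrt (sigma2 A))) 0 ∧
    (sigma2 A * sigma2 B - sigma2Polar A B ^ 2) / (sigma2 A * Real.sqrt (sigma2 A)) ≤ 0 := by
  have hA2 : 0 < sigma2 A := hΓA.2
  have hsA : 0 < Real.sqrt (sigma2 A) := Real.sqrt_pos.2 hA2
  have h0 : sigma2 (fun a b ↦ A a b + (0 : ℝ) * B a b) = sigma2 A := by
    simp only [zero_mul, add_zero]
  have hCS := sigma2_mul_sigma2_le_sq_sigma2Polar hA hB hΓA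
  refine ⟨?_, ?_⟩
  · -- quotient rule at `s = 0`
    have hN : HasDerivAt (fun s : ℝ ↦ sigma2Polar A B + sigma2 B * s) (sigma2 B) 0 := by
      simpa using ((hasDerivAt_id (0 : ℝ)).const_mul (sigma2 B)).const_add (sigma2Polar A B)
    have hD : HasDerivAt (fun s : ℝ ↦ Real.sqrt (sigma2 (fun a b ↦ A a b + s * B a b)))
        (sigma2Polar A B / Real.sqrt (sigma2 A)) 0 := by
      have h := hasDerivAt_sqrt_sigma2_line hA hB (s := 0) (by rw [h0]; exact hA2)
      rw [h0] at h
      simpa using h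
    have hD0 : Real.sqrt (sigma2 (fun a b ↦ A a b + (0 : ℝ) * B a b)) ≠ 0 := by
      rw [h0]; exact hsA.ne'
    have h := hN.div hD hD0
    rw [h0] at h
    simp only [mul_zero, add_zero] at h
    refine h.congr_deriv ?_
    set r := Real.sqrt (sigma2 A) with hr
    have hr0 : r ≠ 0 := hsA.ne'
    have hsq : sigma2 A = r ^ 2 := (Real.sq_sqrt hA2.le).symm
    rw [hsq]
    field_simp
  · have hnum : sigma2 A * sigma2 B - sigma2Polar A B ^ 2 ≤ 0 := by linarith
    exact div_nonpos_iff.2 (Or.inr ⟨hnum, by positivity⟩)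

end ReverseCS

/-! ### A smooth square-root cutoff -/

/-- **Smooth square-root cutoff**: for `c > 0` there is `ψ ∈ C^∞(ℝ)` with `ψ(s) = √s` for
`s ≥ c/2` and `ψ(s) ≥ √(c/4) > 0` for all `s` (`ψ = √θ`, `θ(s) = c/4 + (s − c/4)χ((s − c/4)/(c/4))`
with Mathlib's smooth transition `χ`). [folklore] -/
theorem exists_smooth_sqrt_cutoff {c : ℝ} (hc : 0 < c) :
    ∃ ψ : ℝ → ℝ, ContDiff ℝ ∞ ψ ∧ (∀ s, c / 2 ≤ s → ψ s = Real.sqrt s) ∧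
      ∀ s, Real.sqrt (c / 4) ≤ ψ s := by
  set θ : ℝ → ℝ := fun s ↦ c / 4 + (s - c / 4) * Real.smoothTransition ((s - c / 4) / (c / 4))
    with hθ
  have hθ_ge : ∀ s, c / 4 ≤ θ s := fun s ↦ by
    simp only [hθ]
    have : 0 ≤ (s - c / 4) * Real.smoothTransition ((s - c / 4) / (c / 4)) := by
      by_cases hs : s ≤ c / 4
      · rw [Real.smoothTransition.zero_of_nonpos (div_nonpos_iff.2 (Or.inr ⟨by linarith, by linarith⟩)),
          mul_zero]
      · exact mul_nonneg (by linarith) (Real.smoothTransition.nonneg _)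
    linarith
  have hθ_eq : ∀ s, c / 2 ≤ s → θ s = s := fun s hs ↦ by
    simp only [hθ]
    rw [Real.smoothTransition.one_of_one_le ((one_le_div (by linarith)).2 (by linarith)), mul_one]
    ring
  have hθ_smooth : ContDiff ℝ ∞ θ := by
    have h1 : ContDiff ℝ ∞ fun s : ℝ ↦ (s - c / 4) / (c / 4) :=
      (contDiff_id.sub contDiff_const).div_const _
    exact contDiff_const.add ((contDiff_id.sub contDiff_const).mul
      (Real.smoothTransition.contDiff.comp h1))
  refine ⟨fun s ↦ Real.sqrt (θ s), ?_, fun s hs ↦ by simp only [hθ_eq s hs], fun s ↦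
    Real.sqrt_le_sqrt (hθ_ge s)⟩
  rw [contDiff_iff_contDiffAt]
  intro s
  have hne : θ s ≠ 0 := by linarith [hθ_ge s]
  exact (Real.contDiffAt_sqrt hne).comp s hθ_smooth.contDiffAt

end Literature.Geometry.Riemannian.GurskyViaclovsky

end
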